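import Literature.AnabelianGeometry.SemiGraphs.CovObjPointPresentation
import HarnessLib

/-!
# The underlying semi-graph of a Galois covering is the coset semi-graph of its point presentation ([SemiAnbd] Def 2.2 (i), Rmk 2.2.1, §3 p. 41)

Mochizuki, *Semi-graphs of anabelioids*, Publ. RIMS **42** (2006), Def. 2.2 (i) p. 23 ("the vertices of
`𝒢'` that lie over `v` [are] the connected components of `S_v`"; branches ↔ double cosets), Rmk. 2.2.1
p. 24 (images of `Π_v`, `Π_b` = stabilisers) and §3 proof of Thm. 3.7 (iii) p. 41 (the semi-graphs
`𝒢_{∞,i}` of the Galois tower) [cite: MochizukiSemiAnbd2006, Def. 2.2(i) p.23].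

DICTIONARY, part 2 (cell row T54-B, tower third, file T3a-2; plan/GAP-LEDGER.md G-w4d053-1): for a
connected covering `S` with point-transitive endomorphisms and point data `D : S.PtData`
(`CovObjPointPresentation.lean`), the morphism of semi-graphs
`D.toOrbitGraph : D.ptPresentation.cosetGraph ⊥ ⟶ S.orbitGraph`, `H_w y ↦ orbit(y⁻¹ · x_w)`,
`M_e y ↦ orbit(y⁻¹ · glue_{β e}⁻¹ x_{ν e})`; it lies OVER `𝔾` (`toOrbitGraph_comp_proj`), intertwines
the deck action `deckAct ⊥ q` with `orbitGraphMap q` (`deckAct_comp_toOrbitGraph`), and is bijective on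
vertices, edges and branches (Def. 2.2 (i) / Rmk. 2.2.1 via abc-iut-L3-t11's `mk_aut_eq_mk_aut_iff`,
transitivity and rigidity), hence an isomorphism `D.cosetGraphIsoOrbitGraph` (`Hom.isoOfBijective`).
With `SubgroupPresentation.cosetGraphMapIso` along `π₁^temp ↠ Aut(𝒢_{∞,n})` this identifies the
trees of the Galois tower with coset semi-graphs of `π₁^temp(𝒢)`.  Nothing here bears on [IUTchIII]
Cor. 3.12.
-/

namespace Literature.AnabelianGeometry.SemiGraphs

namespace ProfiniteSemiGraph

open CategoryTheory
open Literature.AlgebraicGeometry.Frobenioids.QuasiTemperoid.BTempConnected (ρ_one_apply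
  ρ_mul_apply ρ_inv_apply ρ_apply_inv)

universe u

variable {𝒢 : ProfiniteSemiGraph.{u}} {S : CovObj 𝒢}
  (hconn : ∀ p q : S.Point, S.SameComponent p q)
  (htrans : ∀ (v : 𝒢.graph.Vertex) (x x' : (S.SV v).obj.V), ∃ σ : S ⟶ S, (σ.fV v).hom.hom x = x')
  (D : S.PtData)

/-! ### The explicit conjugation identity of the branch elements -/

/-- **Explicit form of the branch inclusion** (part 1's `brAut_conj_mem` gives the `∃`): for
`g ∈ Π_{e(β e)}` and a branch `b : e → w`, `t_b⁻¹ ψ_{x_ν}(β_*(g)) t_b = ψ_{x_w}((b_*(g⁻¹))⁻¹)` — gluing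
equivariance along both branches + rigidity. [cite: MochizukiSemiAnbd2006, Rmk. 2.2.1 p.24] -/
theorem CovObj.PtData.brAut_conj_eq (b : 𝒢.graph.Branch) (w : 𝒢.graph.Vertex)
    (hw : 𝒢.graph.abuts b = some w) (g : 𝒢.Ge (𝒢.graph.edgeOf (D.β (𝒢.graph.edgeOf b)))) :
    (D.brAut hconn htrans b w hw)⁻¹ *
        S.ptHom hconn htrans (D.x (D.ν (𝒢.graph.edgeOf b)))
          (𝒢.brHom (D.β (𝒢.graph.edgeOf b)) (D.ν (𝒢.graph.edgeOf b)) (D.abuts_β _) g) *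
        D.brAut hconn htrans b w hw =
      S.ptHom hconn htrans (D.x w) (𝒢.brHom b w hw (D.edgeOf_β (𝒢.graph.edgeOf b) ▸ g⁻¹))⁻¹ := by
  have key : D.brAut hconn htrans b w hw *
        S.ptHom hconn htrans (D.x w) (𝒢.brHom b w hw (D.edgeOf_β (𝒢.graph.edgeOf b) ▸ g⁻¹))⁻¹ =
      S.ptHom hconn htrans (D.x (D.ν (𝒢.graph.edgeOf b)))
          (𝒢.brHom (D.β (𝒢.graph.edgeOf b)) (D.ν (𝒢.graph.edgeOf b)) (D.abuts_β _) g) *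
        D.brAut hconn htrans b w hw := by
    refine S.aut_eq_of_fV_eq hconn (D.x w) ?_
    rw [CovObj.aut_mul_fV_apply, CovObj.aut_mul_fV_apply, S.ptHom_inv_apply, CovHom.fV_ρ,
      D.brAut_apply hconn htrans]
    unfold CovObj.PtData.brPt
    rw [S.fV_glueV]
    dsimp only
    rw [D.ptHom_fE_ePt hconn htrans]
    exact (S.glueV_ρ b w hw _ (D.edgeOf_β _) g⁻¹ (D.ePt (𝒢.graph.edgeOf b))).symm
  calc (D.brAut hconn htrans b w hw)⁻¹ * S.ptHom hconn htrans (D.x (D.ν (𝒢.graph.edgeOf b)))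
          (𝒢.brHom (D.β (𝒢.graph.edgeOf b)) (D.ν (𝒢.graph.edgeOf b)) (D.abuts_β _) g) *
        D.brAut hconn htrans b w hw
      = (D.brAut hconn htrans b w hw)⁻¹ * (S.ptHom hconn htrans (D.x (D.ν (𝒢.graph.edgeOf b)))
          (𝒢.brHom (D.β (𝒢.graph.edgeOf b)) (D.ν (𝒢.graph.edgeOf b)) (D.abuts_β _) g) *
            D.brAut hconn htrans b w hw) := by group
    _ = _ := by rw [← key]; group

section Iso

include hconn htrans

/-- The vertex map on representatives: `(w, y) ↦ orbit(y⁻¹ · x_w)`. [cite: MochizukiSemiAnbd2006, Def. 2.2(i) p.23] -/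
noncomputable def CovObj.PtData.vtxOf (w : 𝒢.graph.Vertex) (y : Aut S) : S.OVertex :=
  Quot.mk S.VRel ⟨w, ((y⁻¹).hom.fV w).hom.hom (D.x w)⟩

/-- The edge map on representatives: `(e, y) ↦ orbit(y⁻¹ · ePt e)`. [cite: MochizukiSemiAnbd2006, Def. 2.2(i) p.23] -/
noncomputable def CovObj.PtData.edgeOf' (e : 𝒢.graph.Edge) (y : Aut S) : S.OEdge :=
  Quot.mk S.ERel ⟨𝒢.graph.edgeOf (D.β e), ((y⁻¹).hom.fE _).hom.hom (D.ePt e)⟩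

omit hconn htrans in
/-- The edge map lands over the right edge. [cite: MochizukiSemiAnbd2006, Def. 2.2(i) p.23] -/
theorem CovObj.PtData.base_edgeOf' (e : 𝒢.graph.Edge) (y : Aut S) :
    CovObj.OEdge.base S (D.edgeOf' e y) = e := D.edgeOf_β e

/-- The vertex map respects the classes `ψ_{x_w}(Π_w) y`. [cite: MochizukiSemiAnbd2006, Def. 2.2(i) p.23] -/
theorem CovObj.PtData.vtxOf_eq_of_rel (w : 𝒢.graph.Vertex) {y y' : Aut S}
    (hrel : DoubleCoset.mk ((D.ptPresentation hconn htrans).H w) ⊥ y =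
      DoubleCoset.mk ((D.ptPresentation hconn htrans).H w) ⊥ y') :
    D.vtxOf w y = D.vtxOf w y' := by
  obtain ⟨a, ⟨k, rfl⟩, c, hc, rfl⟩ := (DoubleCoset.eq _ _ _ _).mp hrel
  rw [Subgroup.mem_bot] at hc
  subst hc
  unfold CovObj.PtData.vtxOf
  refine Quot.sound ?_
  have : (S.ptHom hconn htrans (D.x w) k * y * 1)⁻¹ = y⁻¹ * S.ptHom hconn htrans (D.x w) k⁻¹ := by
    rw [mul_one, mul_inv_rev, map_inv]
  rw [this, CovObj.aut_mul_fV_apply, S.ptHom_inv_apply, CovHom.fV_ρ]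
  exact CovObj.VRel.mk w k _

/-- The edge map respects the classes `ψ_{x_ν}(Π_{β e}) y`. [cite: MochizukiSemiAnbd2006, Def. 2.2(i) p.23] -/
theorem CovObj.PtData.edgeOf'_eq_of_rel (e : 𝒢.graph.Edge) {y y' : Aut S}
    (hrel : DoubleCoset.mk ((D.ptPresentation hconn htrans).M e) ⊥ y =
      DoubleCoset.mk ((D.ptPresentation hconn htrans).M e) ⊥ y') :
    D.edgeOf' e y = D.edgeOf' e y' := by
  obtain ⟨a, ⟨k, ⟨g, hg⟩, rfl⟩, c, hc, rfl⟩ := (DoubleCoset.eq _ _ _ _).mp hrel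
  obtain rfl : k = 𝒢.brHom _ _ _ g := hg.symm
  rw [Subgroup.mem_bot] at hc
  subst hc
  unfold CovObj.PtData.edgeOf'
  refine Quot.sound ?_
  have : (S.ptHom hconn htrans (D.x (D.ν e)) (𝒢.brHom (D.β e) (D.ν e) (D.abuts_β e) g) * y * 1)⁻¹ =
      y⁻¹ * S.ptHom hconn htrans (D.x (D.ν e)) (𝒢.brHom (D.β e) (D.ν e) (D.abuts_β e) g⁻¹) := by
    rw [mul_one, mul_inv_rev, ← map_inv, ← map_inv]
  rw [this, CovObj.aut_mul_fE_apply, D.ptHom_fE_ePt hconn htrans e g⁻¹, inv_inv, CovHom.fE_ρ]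
  exact CovObj.ERel.mk _ g _

/-- **The comparison morphism `(D.ptPresentation).cosetGraph ⊥ ⟶ S.orbitGraph`**: `H_w y ↦ orbit(y⁻¹ ·
x_w)`, `M_e y ↦ orbit(y⁻¹ · ePt e)`. [cite: MochizukiSemiAnbd2006, Def. 2.2(i) p.23] -/
noncomputable def CovObj.PtData.toOrbitGraph :
    (D.ptPresentation hconn htrans).cosetGraph ⊥ ⟶ S.orbitGraph where
  vertexMap q := Quotient.liftOn' q.2 (fun y => D.vtxOf q.1 y)
    (fun y y' h => D.vtxOf_eq_of_rel hconn htrans q.1 (Quotient.sound' h))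
  edgeMap q := Quotient.liftOn' q.2 (fun y => D.edgeOf' q.1 y)
    (fun y y' h => D.edgeOf'_eq_of_rel hconn htrans q.1 (Quotient.sound' h))
  branchMap p := ⟨(p.1.1, Quotient.liftOn' p.1.2.2 (fun y => D.edgeOf' p.1.2.1 y)
    (fun y y' h => D.edgeOf'_eq_of_rel hconn htrans p.1.2.1 (Quotient.sound' h))), by
      obtain ⟨⟨b, e, q⟩, he⟩ := p
      induction q using Quotient.inductionOn' with
      | h y => exact (D.base_edgeOf' e y).trans he⟩
  edgeOf_branchMap _ := rfl
  branchMap_injOn := by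
    rintro ⟨⟨b₁, E₁⟩, h₁⟩ ⟨⟨b₂, E₂⟩, h₂⟩ (hE : E₁ = E₂) h
    subst hE
    have hb : b₁ = b₂ := congrArg (fun p : S.orbitGraph.Branch => p.1.1) h
    subst hb
    rfl
  abuts_branchMap := by
    intro p V hV
    obtain ⟨b, y, rfl⟩ := (D.ptPresentation hconn htrans).bMk_surjective ⊥ p
    rcases hab : 𝒢.graph.abuts b with _ | w
    · rw [(D.ptPresentation hconn htrans).cosetGraph_abuts_bMk_none ⊥ b hab y] at hV
      exact absurd hV (by simp)
    · rw [(D.ptPresentation hconn htrans).cosetGraph_abuts_bMk ⊥ b w hab y] at hV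
      cases hV
      change S.orbitGraph.abuts ⟨(b, D.edgeOf' (𝒢.graph.edgeOf b) y), _⟩ =
        some (D.vtxOf w ((D.ptPresentation hconn htrans).s b * y))
      rw [S.orbitGraph_abuts_of_abuts b _ _ w hab]
      unfold CovObj.PtData.edgeOf'
      rw [S.glueOpt_mk' b w hab _ (D.edgeOf_β _)]
      refine congrArg some ?_
      unfold CovObj.PtData.vtxOf
      change _ = Quot.mk S.VRel ⟨w, (((D.brElt hconn htrans b * y)⁻¹).hom.fV w).hom.hom (D.x w)⟩
      rw [D.brElt_of_abuts hconn htrans b w hab, mul_inv_rev, inv_inv, CovObj.aut_mul_fV_apply,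
        D.brAut_apply hconn htrans]
      unfold CovObj.PtData.brPt
      rw [S.fV_glueV]

/-- The comparison morphism on vertex representatives. [cite: MochizukiSemiAnbd2006, Def. 2.2(i) p.23] -/
theorem CovObj.PtData.toOrbitGraph_vertexMap_vMk (w : 𝒢.graph.Vertex) (y : Aut S) :
    (D.toOrbitGraph hconn htrans).vertexMap ((D.ptPresentation hconn htrans).vMk ⊥ w y) =
      Quot.mk S.VRel ⟨w, ((y⁻¹).hom.fV w).hom.hom (D.x w)⟩ := rfl

/-- The comparison morphism on edge representatives. [cite: MochizukiSemiAnbd2006, Def. 2.2(i) p.23] -/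
theorem CovObj.PtData.toOrbitGraph_edgeMap_eMk (e : 𝒢.graph.Edge) (y : Aut S) :
    (D.toOrbitGraph hconn htrans).edgeMap ((D.ptPresentation hconn htrans).eMk ⊥ e y) =
      Quot.mk S.ERel ⟨𝒢.graph.edgeOf (D.β e), ((y⁻¹).hom.fE _).hom.hom (D.ePt e)⟩ := rfl

/-- **The comparison morphism lies over `𝔾`.** [cite: MochizukiSemiAnbd2006, Def. 2.2(i) p.23] -/
theorem CovObj.PtData.toOrbitGraph_comp_proj :
    D.toOrbitGraph hconn htrans ≫ S.orbitGraphProj = (D.ptPresentation hconn htrans).cosetGraphProj ⊥ := by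
  refine (D.ptPresentation hconn htrans).hom_ext_mk ⊥ _ _ (fun w y => rfl)
    (fun e y => D.base_edgeOf' e y) (fun b y => rfl)

/-- **The comparison morphism intertwines the deck action with the action of `Aut S` on the orbit
graph**: `deckAct ⊥ q` corresponds to `orbitGraphMap q`. [cite: MochizukiSemiAnbd2006, Rmk. 2.2.1 p.24] -/
theorem CovObj.PtData.deckAct_comp_toOrbitGraph (q : Aut S) :
    ((D.ptPresentation hconn htrans).deckAct ⊥ q).hom ≫ D.toOrbitGraph hconn htrans =
      D.toOrbitGraph hconn htrans ≫ CovObj.orbitGraphMap q.hom := by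
  refine (D.ptPresentation hconn htrans).hom_ext_mk ⊥ _ _ (fun w y => ?_) (fun e y => ?_)
    (fun b y => ?_)
  · change (D.toOrbitGraph hconn htrans).vertexMap ((D.ptPresentation hconn htrans).vMk ⊥ w (y * q⁻¹))
      = CovObj.OVertex.map q.hom ((D.toOrbitGraph hconn htrans).vertexMap
          ((D.ptPresentation hconn htrans).vMk ⊥ w y))
    rw [D.toOrbitGraph_vertexMap_vMk, D.toOrbitGraph_vertexMap_vMk, mul_inv_rev, inv_inv]
    rfl
  · change (D.toOrbitGraph hconn htrans).edgeMap ((D.ptPresentation hconn htrans).eMk ⊥ e (y * q⁻¹))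
      = CovObj.OEdge.map q.hom ((D.toOrbitGraph hconn htrans).edgeMap
          ((D.ptPresentation hconn htrans).eMk ⊥ e y))
    rw [D.toOrbitGraph_edgeMap_eMk, D.toOrbitGraph_edgeMap_eMk, mul_inv_rev, inv_inv]
    rfl
  · refine Subtype.ext (Prod.ext rfl ?_)
    change (D.toOrbitGraph hconn htrans).edgeMap
        ((D.ptPresentation hconn htrans).eMk ⊥ (𝒢.graph.edgeOf b) (y * q⁻¹)) =
      CovObj.OEdge.map q.hom ((D.toOrbitGraph hconn htrans).edgeMap
        ((D.ptPresentation hconn htrans).eMk ⊥ (𝒢.graph.edgeOf b) y))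
    rw [D.toOrbitGraph_edgeMap_eMk, D.toOrbitGraph_edgeMap_eMk, mul_inv_rev, inv_inv]
    rfl

/-- The comparison morphism is injective on vertices (Def. 2.2 (i): vertices over `w` ↔ cosets of
`ψ_{x_w}(Π_w)`). [cite: MochizukiSemiAnbd2006, Def. 2.2(i) p.23] -/
theorem CovObj.PtData.toOrbitGraph_vertexMap_injective :
    Function.Injective (D.toOrbitGraph hconn htrans).vertexMap := by
  intro q q' h
  obtain ⟨w, y, rfl⟩ := (D.ptPresentation hconn htrans).vMk_surjective ⊥ q
  obtain ⟨w', y', rfl⟩ := (D.ptPresentation hconn htrans).vMk_surjective ⊥ q'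
  rw [D.toOrbitGraph_vertexMap_vMk, D.toOrbitGraph_vertexMap_vMk] at h
  have hw : w = w' := congrArg (CovObj.OVertex.base S) h
  subst hw
  have hmem := (S.mk_aut_eq_mk_aut_iff hconn htrans (D.x w) y⁻¹ y'⁻¹).mp h
  rw [inv_inv] at hmem
  exact congrArg (Sigma.mk w) ((DoubleCoset.eq _ _ _ _).mpr
    ⟨y' * y⁻¹, hmem, 1, (Subgroup.mem_bot).mpr rfl, by group⟩)

/-- The comparison morphism is surjective on vertices (transitivity of `Aut S` on the fibres).
[cite: MochizukiSemiAnbd2006, Def. 2.2(i) p.23] -/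
theorem CovObj.PtData.toOrbitGraph_vertexMap_surjective :
    Function.Surjective (D.toOrbitGraph hconn htrans).vertexMap := by
  intro V
  induction V using Quot.ind with
  | mk p =>
    obtain ⟨w, z⟩ := p
    obtain ⟨σ, hσ⟩ := S.exists_aut_fV_eq hconn htrans (D.x w) z
    refine ⟨(D.ptPresentation hconn htrans).vMk ⊥ w σ⁻¹, ?_⟩
    rw [D.toOrbitGraph_vertexMap_vMk, inv_inv, hσ]

/-- The comparison morphism is injective on edges (Def. 2.2 (i): branches over `b` ↔ cosets of
`ψ_{x_v}(Π_b)`). [cite: MochizukiSemiAnbd2006, Def. 2.2(i) p.23] -/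
theorem CovObj.PtData.toOrbitGraph_edgeMap_injective :
    Function.Injective (D.toOrbitGraph hconn htrans).edgeMap := by
  intro q q' h
  obtain ⟨e, y, rfl⟩ := (D.ptPresentation hconn htrans).eMk_surjective ⊥ q
  obtain ⟨e', y', rfl⟩ := (D.ptPresentation hconn htrans).eMk_surjective ⊥ q'
  rw [D.toOrbitGraph_edgeMap_eMk, D.toOrbitGraph_edgeMap_eMk] at h
  have he : e = e' := by
    have := congrArg (CovObj.OEdge.base S) h
    change 𝒢.graph.edgeOf (D.β e) = 𝒢.graph.edgeOf (D.β e') at this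
    rwa [D.edgeOf_β, D.edgeOf_β] at this
  subst he
  obtain ⟨g, hg⟩ := S.exists_ρE_of_mk_eq_mk h
  -- push along `glue_{β e}` to the vertex fibre over `ν e`
  have hg' := congrArg (S.glue (D.β e) (D.ν e) (D.abuts_β e)).hom.hom.hom hg
  rw [S.glue_ρ, CovHom.glue_fE, CovHom.glue_fE] at hg'
  unfold CovObj.PtData.ePt at hg'
  rw [S.glue_hom_inv, ← CovHom.fV_ρ, ← S.ptHom_inv_apply hconn htrans,
    ← CovObj.aut_mul_fV_apply] at hg'
  have hy : y⁻¹ * S.ptHom hconn htrans (D.x (D.ν e)) (𝒢.brHom (D.β e) (D.ν e) (D.abuts_β e) g)⁻¹ = y'⁻¹ :=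
    S.aut_eq_of_fV_eq hconn (D.x (D.ν e)) hg'
  refine congrArg (Sigma.mk e) ((DoubleCoset.eq _ _ _ _).mpr
    ⟨S.ptHom hconn htrans (D.x (D.ν e)) (𝒢.brHom (D.β e) (D.ν e) (D.abuts_β e) g),
      ⟨_, ⟨g, rfl⟩, rfl⟩, 1, (Subgroup.mem_bot).mpr rfl, ?_⟩)
  have := congrArg (·⁻¹) hy
  simp only [mul_inv_rev, inv_inv, map_inv] at this
  rw [← this, mul_one]

/-- The comparison morphism is surjective on edges. [cite: MochizukiSemiAnbd2006, Def. 2.2(i) p.23] -/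
theorem CovObj.PtData.toOrbitGraph_edgeMap_surjective :
    Function.Surjective (D.toOrbitGraph hconn htrans).edgeMap := by
  intro E
  induction E using Quot.ind with
  | mk p =>
    obtain ⟨e, z⟩ := p
    obtain ⟨σ, hσ⟩ := S.exists_aut_fV_eq hconn htrans (D.x (D.ν e))
      (S.glueV (D.β e) (D.ν e) (D.abuts_β e) ⟨e, z⟩ (D.edgeOf_β e).symm)
    refine ⟨(D.ptPresentation hconn htrans).eMk ⊥ e σ⁻¹, ?_⟩
    rw [D.toOrbitGraph_edgeMap_eMk, inv_inv]
    unfold CovObj.PtData.ePt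
    rw [S.fE_glue_inv, hσ]
    exact S.oEdge_mk_glue_inv_glueV (D.β e) (D.ν e) (D.abuts_β e) ⟨e, z⟩ (D.edgeOf_β e).symm

/-- The comparison morphism is bijective on branches. [cite: MochizukiSemiAnbd2006, Def. 2.2(i) p.23] -/
theorem CovObj.PtData.toOrbitGraph_branchMap_bijective :
    Function.Bijective (D.toOrbitGraph hconn htrans).branchMap := by
  constructor
  · rintro ⟨⟨b₁, E₁⟩, h₁⟩ ⟨⟨b₂, E₂⟩, h₂⟩ h
    have hb : b₁ = b₂ := congrArg (fun p : S.orbitGraph.Branch => p.1.1) h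
    subst hb
    have hE : (D.toOrbitGraph hconn htrans).edgeMap E₁ = (D.toOrbitGraph hconn htrans).edgeMap E₂ :=
      congrArg (fun p : S.orbitGraph.Branch => p.1.2) h
    have := D.toOrbitGraph_edgeMap_injective hconn htrans hE
    subst this
    rfl
  · rintro ⟨⟨b, E⟩, hE⟩
    obtain ⟨q, hq⟩ := D.toOrbitGraph_edgeMap_surjective hconn htrans E
    have hq1 : q.1 = 𝒢.graph.edgeOf b := by
      have := congrArg (CovObj.OEdge.base S) hq
      rw [← hE, ← this]
      obtain ⟨e, y, rfl⟩ := (D.ptPresentation hconn htrans).eMk_surjective ⊥ q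
      exact (D.base_edgeOf' e y).symm
    refine ⟨⟨(b, q), hq1⟩, Subtype.ext (Prod.ext rfl hq)⟩

/-- **The underlying semi-graph of a connected covering with point-transitive endomorphisms IS the coset
semi-graph of its point presentation**: `(D.ptPresentation).cosetGraph ⊥ ≅ S.orbitGraph`.
[cite: MochizukiSemiAnbd2006, Def. 2.2(i) p.23] -/
noncomputable def CovObj.PtData.cosetGraphIsoOrbitGraph :
    (D.ptPresentation hconn htrans).cosetGraph ⊥ ≅ S.orbitGraph :=
  SemiGraph.Hom.isoOfBijective (D.toOrbitGraph hconn htrans)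
    ⟨D.toOrbitGraph_vertexMap_injective hconn htrans, D.toOrbitGraph_vertexMap_surjective hconn htrans⟩
    ⟨D.toOrbitGraph_edgeMap_injective hconn htrans, D.toOrbitGraph_edgeMap_surjective hconn htrans⟩
    (D.toOrbitGraph_branchMap_bijective hconn htrans)
    (by
      intro p hp
      obtain ⟨b, y, rfl⟩ := (D.ptPresentation hconn htrans).bMk_surjective ⊥ p
      rcases hab : 𝒢.graph.abuts b with _ | w
      · exact S.orbitGraph_abuts_of_none b _ _ hab
      · rw [(D.ptPresentation hconn htrans).cosetGraph_abuts_bMk ⊥ b w hab y] at hp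
        exact absurd hp (by simp))

/-- The `hom` of the comparison isomorphism. [cite: MochizukiSemiAnbd2006, Def. 2.2(i) p.23] -/
@[simp] theorem CovObj.PtData.cosetGraphIsoOrbitGraph_hom :
    (D.cosetGraphIsoOrbitGraph hconn htrans).hom = D.toOrbitGraph hconn htrans := rfl

end Iso

end ProfiniteSemiGraph

end Literature.AnabelianGeometry.SemiGraphs
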